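import Literature.Barriers.CriticalPhenomena.LaceExpansionKernelDerivatives
import Literature.Barriers.CriticalPhenomena.HaraGaussianLemmaHeatKernel
import Mathlib.Analysis.Calculus.IteratedDeriv.Lemmas
import HarnessLib

/-!
# Higher coordinate derivatives of the lattice Fourier transform (for Hara 2008, §4, Lemma 4.1)

Barrier catalogue `Literature/Barriers/CriticalPhenomena/` (D-0021), analytic infrastructure for the
named fact `Hara2008_lemma17Pc` (`LaceExpansionXSpaceNorms.lean`: Hara 2008, Lemma 1.7, the analytic
lemma of the `x`-space analysis behind `Hara2008_xSpacePiBoundPc`). Hara's §4 works throughout with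
`m`-th partial derivatives `∂_j^m` of `Ĵ`, `ĝ` and `Ĝ = ĝ/(1 - Ĵ)` in ONE coordinate `k_j`
("we abbreviate `∂^m` for `∂^m/∂k₁^m`"), under the moment hypothesis `Σ_x |x|^M |Π(x)| < ∞`
(Lemma 4.1: "`|∂^m ĝ(k)|, |∂^m Ĵ(k)| < ∞` for all `m ≤ M`"). This file PROVES, for a function
`f : ℤ^d → ℝ` with `Σ_x (1 + |x|)^M |f(x)| < ∞`:

* `coordPow j m f = x_j^m f(x)` and the moments `Σ_x |x_j^m f(x)| < ∞` (`m ≤ M`);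
* `latticeFTDn f j m k := (-i)^m (x_j^m f)^(k)` — the `m`-th derivative of `f̂` in `k_j`:
  `hasDerivAt_latticeFT_update` (one derivative under the sharp hypothesis `Σ(|f| + |x_j f|) < ∞`),
  `iteratedDeriv_latticeFT_update` (`iteratedDeriv m (s ↦ f̂(k[j ↦ s])) = s ↦ ∂_j^m f̂(k[j ↦ s])` for
  `m ≤ M`), `contDiff_latticeFT_update` (the slice is `C^M`);
* the bounds `|∂_j^m f̂(k)| ≤ Σ_x (1 + |x|)^M |f(x)|` and, for a `ℤ^d`-symmetric `f`, the vanishing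
  of the first derivative at the hyperplane `k_j = 0` in the quantitative forms
  `|∂_j f̂(k)| ≤ (Σ_x |x|²|f(x)|) |k_j|` (`norm_latticeFTDn_one_le_abs`) and `≤ (Σ_x |x|²|f(x)|) |k|`
  (`norm_latticeFTDn_one_le`, the form Lemma 4.1 consumes) (Hara's (4.22): "because `Ĵ(k)` is
  even in `k_j`, `|∂^ℓ Ĵ(k)| ≤ sup|∂^{ℓ+1} Ĵ| |k|`" — the case `ℓ = 1`, the one Lemma 4.1 needs);
* passage from the real-exponent moment `Σ_x |x|^φ |f(x)| < ∞` of Lemma 1.7 to the natural one.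

The first and second derivatives (`latticeFTD1`, `latticeFTD2 · j j`) of
`LaceExpansionKernelDerivatives.lean` and the coordinate weights `coordMul` of
`HaraGaussianLemmaHeatKernel.lean` are the cases `m = 1, 2`: the bridges
`latticeFTDn_one_eq_latticeFTD1`, `latticeFTDn_two_eq_latticeFTD2` and `latticeFTDn_one`
(`∂_j f̂ = -i (x_j f)^`) identify the three renderings, so that the `D1/D2` lemmas of that file
compose with the `∂^m` results here.

## References

* T. Hara, Ann. Probab. 36 (2008) 530–593 (arXiv:math-ph/0504021): §4.1.2 ((4.8):
  `Ĝ_j^{(2n)}(k) = (-1)^n ∂_j^{2n} Ĝ(k)`), Lemma 4.1 and its proof (§4.2: (4.20) "`|∂^m ĝ|, |∂^m Ĵ| < ∞`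
  for all `m ≤ M`", (4.22)).
-/

noncomputable section

namespace Literature.Barriers.CriticalPhenomena

open Filter Finset Literature.Probability.LatticeModels Literature.Probability.Percolation
open scoped Topology BigOperators

variable {d : ℕ}

/-! ### Coordinate powers `x_j^m f(x)` and their moments -/

/-- `x_j^m f(x)`, the function whose lattice Fourier transform is `(i∂_j)^m f̂`.
[cite: Hara2008, §4.1.2 ((4.8))] -/
def coordPow (j : Fin d) (m : ℕ) (f : Site d → ℝ) (x : Site d) : ℝ := ((x j : ℤ) : ℝ) ^ m * f x

/-- `x_j^0 f = f`. [folklore] -/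
@[simp] theorem coordPow_zero (j : Fin d) (f : Site d → ℝ) : coordPow j 0 f = f := by
  funext x
  simp [coordPow]

/-- `x_j^{m+1} f = x_j (x_j^m f)`. [folklore] -/
theorem coordPow_succ (j : Fin d) (m : ℕ) (f : Site d → ℝ) :
    coordPow j (m + 1) f = coordMul j (coordPow j m f) := by
  funext x
  simp only [coordPow, coordMul, pow_succ]
  ring

/-- `x_j^1 f = x_j f`. [folklore] -/
theorem coordPow_one (j : Fin d) (f : Site d → ℝ) : coordPow j 1 f = coordMul j f := by
  rw [coordPow_succ, coordPow_zero]

/-- `|x_j^m f(x)| ≤ (1 + |x|)^m |f(x)|`. [folklore] -/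
theorem abs_coordPow_le (j : Fin d) (m : ℕ) (f : Site d → ℝ) (x : Site d) :
    |coordPow j m f x| ≤ (1 + euclidNorm x) ^ m * |f x| := by
  rw [coordPow, abs_mul, abs_pow]
  have h1 : |((x j : ℤ) : ℝ)| ≤ 1 + euclidNorm x := by
    linarith [abs_apply_le_euclidNorm x j, euclidNorm_nonneg x]
  exact mul_le_mul_of_nonneg_right (pow_le_pow_left₀ (abs_nonneg _) h1 m) (abs_nonneg _)

/-- `(1 + |x|)^m |f(x)| ≤ (1 + |x|)^M |f(x)|` for `m ≤ M`. [folklore] -/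
theorem one_add_pow_mul_abs_mono {m M : ℕ} (h : m ≤ M) (f : Site d → ℝ) (x : Site d) :
    (1 + euclidNorm x) ^ m * |f x| ≤ (1 + euclidNorm x) ^ M * |f x| :=
  mul_le_mul_of_nonneg_right (pow_le_pow_right₀ (by linarith [euclidNorm_nonneg x]) h)
    (abs_nonneg _)

/-- `0 ≤ (1 + |x|)^n |f(x)|`. [folklore] -/
theorem moment_term_nonneg (n : ℕ) (f : Site d → ℝ) (x : Site d) :
    0 ≤ (1 + euclidNorm x) ^ n * |f x| :=
  mul_nonneg (pow_nonneg (by linarith [euclidNorm_nonneg x]) n) (abs_nonneg _)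

/-- **Moments**: `Σ_x |x_j^m f(x)| < ∞` for `m ≤ M` when `Σ_x (1 + |x|)^M |f(x)| < ∞` (Hara's
"`Σ_x |x|^M |Π(x)| < ∞`"). [cite: Hara2008, Lemma 4.1 ((4.6))] -/
theorem summable_abs_coordPow {f : Site d → ℝ} {M : ℕ}
    (hM : Summable fun x => (1 + euclidNorm x) ^ M * |f x|) (j : Fin d) {m : ℕ} (hm : m ≤ M) :
    Summable fun x => |coordPow j m f x| :=
  Summable.of_nonneg_of_le (fun _ => abs_nonneg _)
    (fun x => (abs_coordPow_le j m f x).trans (one_add_pow_mul_abs_mono hm f x)) hM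

/-- The lower moments are finite too. [folklore] -/
theorem summable_one_add_pow_mul_abs_of_le {f : Site d → ℝ} {M : ℕ}
    (hM : Summable fun x => (1 + euclidNorm x) ^ M * |f x|) {m : ℕ} (hm : m ≤ M) :
    Summable fun x => (1 + euclidNorm x) ^ m * |f x| :=
  Summable.of_nonneg_of_le (fun x => moment_term_nonneg m f x)
    (fun x => one_add_pow_mul_abs_mono hm f x) hM

/-- In particular `Σ_x |f(x)| < ∞`. [folklore] -/
theorem summable_abs_of_moment {f : Site d → ℝ} {M : ℕ}
    (hM : Summable fun x => (1 + euclidNorm x) ^ M * |f x|) : Summable fun x => |f x| := by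
  simpa using summable_one_add_pow_mul_abs_of_le hM (Nat.zero_le M)

/-- And `Σ_x |x|² |f(x)| < ∞` when `M ≥ 2`. [folklore] -/
theorem summable_sq_mul_abs_of_moment {f : Site d → ℝ} {M : ℕ}
    (hM : Summable fun x => (1 + euclidNorm x) ^ M * |f x|) (h2 : 2 ≤ M) :
    Summable fun x => euclidNorm x ^ 2 * |f x| := by
  refine Summable.of_nonneg_of_le (fun x => mul_nonneg (sq_nonneg _) (abs_nonneg _)) (fun x => ?_)
    (summable_one_add_pow_mul_abs_of_le hM h2)
  exact mul_le_mul_of_nonneg_right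
    (pow_le_pow_left₀ (euclidNorm_nonneg x) (by linarith [euclidNorm_nonneg x]) 2) (abs_nonneg _)

/-- The moments of `x_j^m f` of order `M - m`: `Σ_x (1 + |x|)^{n} |x_j^m f(x)| < ∞` for `m + n ≤ M`.
[folklore] -/
theorem summable_moment_coordPow {f : Site d → ℝ} {M : ℕ}
    (hM : Summable fun x => (1 + euclidNorm x) ^ M * |f x|) (j : Fin d) {m n : ℕ} (hmn : m + n ≤ M) :
    Summable fun x => (1 + euclidNorm x) ^ n * |coordPow j m f x| := by
  refine Summable.of_nonneg_of_le (fun x => moment_term_nonneg n _ x) (fun x => ?_)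
    (summable_one_add_pow_mul_abs_of_le hM hmn)
  calc (1 + euclidNorm x) ^ n * |coordPow j m f x|
      ≤ (1 + euclidNorm x) ^ n * ((1 + euclidNorm x) ^ m * |f x|) :=
        mul_le_mul_of_nonneg_left (abs_coordPow_le j m f x)
          (pow_nonneg (by linarith [euclidNorm_nonneg x]) n)
    _ = (1 + euclidNorm x) ^ (m + n) * |f x| := by ring

/-- **From the real-exponent moment of Lemma 1.7 to the natural one**: `Σ_x |f(x)| < ∞` and
`Σ_x |x|^φ |f(x)| < ∞` give `Σ_x (1 + |x|)^M |f(x)| < ∞` for every natural `M ≤ φ`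
(`(1 + |x|)^M ≤ 2^M (1 + |x|^φ)`). [cite: Hara2008, Lemma 1.7 (hypothesis Σ_x |x|^φ |Π(x)| < ∞) and Lemma 4.1 ((4.6))] -/
theorem summable_one_add_pow_mul_abs_of_rpow {f : Site d → ℝ} {φ : ℝ} {M : ℕ} (hMφ : (M : ℝ) ≤ φ)
    (h0 : Summable fun x => |f x|) (hφ : Summable fun x => euclidNorm x ^ φ * |f x|) :
    Summable fun x => (1 + euclidNorm x) ^ M * |f x| := by
  have hM0 : (0 : ℝ) ≤ M := Nat.cast_nonneg M
  refine Summable.of_nonneg_of_le (fun x => moment_term_nonneg M f x) (fun x => ?_)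
    ((h0.add hφ).mul_left ((2 : ℝ) ^ M))
  have he := euclidNorm_nonneg x
  -- `(1 + e)^M ≤ 2^M max(1, e)^M ≤ 2^M (1 + e^φ)`
  have hkey : (1 + euclidNorm x) ^ M ≤ 2 ^ M * (1 + euclidNorm x ^ φ) := by
    rcases le_or_gt (euclidNorm x) 1 with h1 | h1
    · calc (1 + euclidNorm x) ^ M ≤ (1 + 1) ^ M := by gcongr
        _ = 2 ^ M * 1 := by norm_num
        _ ≤ 2 ^ M * (1 + euclidNorm x ^ φ) := by
          gcongr
          linarith [Real.rpow_nonneg he φ]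
    · have hpow : euclidNorm x ^ (M : ℝ) ≤ euclidNorm x ^ φ :=
        Real.rpow_le_rpow_of_exponent_le h1.le hMφ
      rw [Real.rpow_natCast] at hpow
      calc (1 + euclidNorm x) ^ M ≤ (euclidNorm x + euclidNorm x) ^ M := by gcongr
        _ = 2 ^ M * euclidNorm x ^ M := by rw [← two_mul, mul_pow]
        _ ≤ 2 ^ M * (1 + euclidNorm x ^ φ) := by
          gcongr
          linarith
  calc (1 + euclidNorm x) ^ M * |f x| ≤ 2 ^ M * (1 + euclidNorm x ^ φ) * |f x| :=
        mul_le_mul_of_nonneg_right hkey (abs_nonneg _)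
    _ = 2 ^ M * (|f x| + euclidNorm x ^ φ * |f x|) := by ring

/-! ### The `m`-th coordinate derivative `∂_j^m f̂` -/

/-- `∂_j^m f̂(k) := (-i)^m Σ_x x_j^m f(x) e^{-ik·x} = (-i)^m (x_j^m f)^(k)` — the `m`-th partial
derivative of the lattice Fourier transform in the coordinate `k_j` (proved to be it in
`iteratedDeriv_latticeFT_update`). [cite: Hara2008, §4.1.2 ((4.8)) and §4.2] -/
def latticeFTDn (f : Site d → ℝ) (j : Fin d) (m : ℕ) (k : Fin d → ℝ) : ℂ :=
  (-Complex.I) ^ m * latticeFT (coordPow j m f) k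

/-- `∂_j^0 f̂ = f̂`. [folklore] -/
@[simp] theorem latticeFTDn_zero (f : Site d → ℝ) (j : Fin d) (k : Fin d → ℝ) :
    latticeFTDn f j 0 k = latticeFT f k := by
  simp [latticeFTDn]

/-- `∂_j^1 f̂ = -i (x_j f)^`. [folklore] -/
theorem latticeFTDn_one (f : Site d → ℝ) (j : Fin d) (k : Fin d → ℝ) :
    latticeFTDn f j 1 k = -Complex.I * latticeFT (coordMul j f) k := by
  simp [latticeFTDn, coordPow_one]

/-- **Bridge to `latticeFTD1`**: `∂_j^1 f̂` is the first-derivative series of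
`LaceExpansionKernelDerivatives.lean`. [folklore] -/
theorem latticeFTDn_one_eq_latticeFTD1 (f : Site d → ℝ) (j : Fin d) (k : Fin d → ℝ) :
    latticeFTDn f j 1 k = latticeFTD1 f j k := by
  unfold latticeFTDn latticeFTD1 latticeFT coordPow
  rw [← tsum_mul_left]
  refine tsum_congr fun x => ?_
  push_cast
  ring

/-- **Bridge to `latticeFTD2`**: `∂_j^2 f̂` is the diagonal second-derivative series
`latticeFTD2 f j j` of `LaceExpansionKernelDerivatives.lean`. [folklore] -/
theorem latticeFTDn_two_eq_latticeFTD2 (f : Site d → ℝ) (j : Fin d) (k : Fin d → ℝ) :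
    latticeFTDn f j 2 k = latticeFTD2 f j j k := by
  unfold latticeFTDn latticeFTD2 latticeFT coordPow
  rw [← tsum_mul_left]
  refine tsum_congr fun x => ?_
  push_cast
  have hI : Complex.I ^ 2 = -1 := Complex.I_sq
  linear_combination (((x j : ℤ) : ℂ) ^ 2 * ((f x : ℂ) *
    Complex.exp (-(Complex.I * (kdot k x : ℂ))))) * hI

/-- `‖(-i)^m‖ = 1`. [folklore] -/
theorem norm_neg_I_pow (m : ℕ) : ‖(-Complex.I) ^ m‖ = 1 := by
  rw [norm_pow, norm_neg, Complex.norm_I, one_pow]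

/-- **`|∂_j^m f̂(k)| ≤ Σ_x |x_j|^m |f(x)| ≤ Σ_x (1 + |x|)^M |f(x)|`** for `m ≤ M` (Hara's (4.20):
"`|∂^m ĝ(k)|, |∂^m Ĵ(k)| < ∞` for all `m ≤ M`"). [cite: Hara2008, proof of Lemma 4.1 ((4.20))] -/
theorem norm_latticeFTDn_le {f : Site d → ℝ} {M : ℕ}
    (hM : Summable fun x => (1 + euclidNorm x) ^ M * |f x|) (j : Fin d) {m : ℕ} (hm : m ≤ M)
    (k : Fin d → ℝ) : ‖latticeFTDn f j m k‖ ≤ ∑' x, (1 + euclidNorm x) ^ M * |f x| := by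
  rw [latticeFTDn, norm_mul, norm_neg_I_pow, one_mul]
  refine (norm_latticeFT_le (summable_abs_coordPow hM j hm) k).trans ?_
  exact Summable.tsum_le_tsum (fun x => (abs_coordPow_le j m f x).trans (one_add_pow_mul_abs_mono hm f x))
    (summable_abs_coordPow hM j hm) hM

/-- `∂_j^m f̂` is continuous (`m ≤ M`). [folklore] -/
theorem continuous_latticeFTDn {f : Site d → ℝ} {M : ℕ}
    (hM : Summable fun x => (1 + euclidNorm x) ^ M * |f x|) (j : Fin d) {m : ℕ} (hm : m ≤ M) :
    Continuous (latticeFTDn f j m) :=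
  continuous_const.mul (continuous_latticeFT (summable_abs_coordPow hM j hm))

/-- `∂_j^m f̂` is `2π`-periodic in each coordinate. [folklore] -/
theorem latticeFTDn_update_add_two_pi (f : Site d → ℝ) (j : Fin d) (m : ℕ) (k : Fin d → ℝ)
    (l : Fin d) (s : ℝ) :
    latticeFTDn f j m (Function.update k l (s + 2 * Real.pi)) =
      latticeFTDn f j m (Function.update k l s) := by
  rw [latticeFTDn, latticeFTDn, latticeFT_update_add_two_pi]

/-! ### Differentiating the slice `s ↦ f̂(k[j ↦ s])` -/

/-- **One derivative in `k_j`** under the sharp hypothesis `Σ_x |f(x)| < ∞`, `Σ_x |x_j f(x)| < ∞`: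
`d/ds f̂(k[j ↦ s]) = -i (x_j f)^(k[j ↦ s])` (termwise differentiation of the absolutely convergent
trigonometric series). [cite: Hara2008, proof of Lemma 4.1 (§4.2, "by explicit differentiation")] -/
theorem hasDerivAt_latticeFT_update {f : Site d → ℝ} (h0 : Summable fun x => |f x|) (j : Fin d)
    (h1 : Summable fun x => |coordMul j f x|) (k : Fin d → ℝ) (s : ℝ) :
    HasDerivAt (fun s : ℝ => latticeFT f (Function.update k j s))
      (-Complex.I * latticeFT (coordMul j f) (Function.update k j s)) s := by
  have hsum : Summable fun x => |((x j : ℤ) : ℝ)| * |f x| := by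
    refine h1.congr fun x => ?_
    rw [coordMul, abs_mul]
  have h := hasDerivAt_tsum hsum (fun x y => hasDerivAt_latticeFT_term f k j x y)
    (fun x y => le_of_eq (norm_latticeFTD1_term f j _ x)) (y₀ := s)
    (summable_latticeFT_term h0 _) s
  have heq : (∑' x : Site d, -(Complex.I * ((x j : ℤ) : ℂ)) *
      ((f x : ℂ) * Complex.exp (-(Complex.I * (kdot (Function.update k j s) x : ℂ))))) =
      -Complex.I * latticeFT (coordMul j f) (Function.update k j s) := by
    unfold latticeFT
    rw [← tsum_mul_left]
    refine tsum_congr fun x => ?_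
    simp only [coordMul]
    push_cast
    ring
  rw [← heq]
  exact h

/-- **The iterated derivative of the slice is `∂_j^m f̂`**: for `m ≤ M`,
`iteratedDeriv m (s ↦ f̂(k[j ↦ s])) = s ↦ (-i)^m (x_j^m f)^(k[j ↦ s])`.
[cite: Hara2008, §4.1.2 ((4.8)) and proof of Lemma 4.1 (§4.2)] -/
theorem iteratedDeriv_latticeFT_update {f : Site d → ℝ} {M : ℕ}
    (hM : Summable fun x => (1 + euclidNorm x) ^ M * |f x|) (k : Fin d → ℝ) (j : Fin d) :
    ∀ m : ℕ, m ≤ M → iteratedDeriv m (fun s : ℝ => latticeFT f (Function.update k j s)) =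
      fun s => latticeFTDn f j m (Function.update k j s) := by
  intro m hm
  induction m with
  | zero =>
    funext s
    simp [latticeFTDn]
  | succ m ih =>
    rw [iteratedDeriv_succ, ih (Nat.le_of_succ_le hm)]
    funext s
    have h0 : Summable fun x => |coordPow j m f x| :=
      summable_abs_coordPow hM j (Nat.le_of_succ_le hm)
    have h1 : Summable fun x => |coordMul j (coordPow j m f) x| := by
      rw [← coordPow_succ]
      exact summable_abs_coordPow hM j hm
    have hd : HasDerivAt (fun s : ℝ => latticeFTDn f j m (Function.update k j s))
        ((-Complex.I) ^ m * (-Complex.I * latticeFT (coordMul j (coordPow j m f))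
          (Function.update (Function.update k j s) j s))) s := by
      have h := (hasDerivAt_latticeFT_update h0 j h1 (Function.update k j s) s).const_mul
        ((-Complex.I) ^ m)
      simp only [Function.update_idem] at h
      simp only [latticeFTDn, Function.update_idem]
      exact h
    rw [hd.deriv, Function.update_idem, latticeFTDn, coordPow_succ, pow_succ]
    ring

/-- Pointwise form: `iteratedDeriv m (s ↦ f̂(k[j ↦ s])) (k_j) = ∂_j^m f̂(k)`. [folklore] -/
theorem iteratedDeriv_latticeFT_update_apply {f : Site d → ℝ} {M : ℕ}
    (hM : Summable fun x => (1 + euclidNorm x) ^ M * |f x|) (k : Fin d → ℝ) (j : Fin d) {m : ℕ}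
    (hm : m ≤ M) :
    iteratedDeriv m (fun s : ℝ => latticeFT f (Function.update k j s)) (k j) = latticeFTDn f j m k := by
  rw [iteratedDeriv_latticeFT_update hM k j m hm]
  simp only [Function.update_eq_self]

/-- **The slice `s ↦ f̂(k[j ↦ s])` is `C^M`** when `Σ_x (1 + |x|)^M |f(x)| < ∞`.
[cite: Hara2008, proof of Lemma 4.1 ((4.20))] -/
theorem contDiff_latticeFT_update {f : Site d → ℝ} {M : ℕ}
    (hM : Summable fun x => (1 + euclidNorm x) ^ M * |f x|) (k : Fin d → ℝ) (j : Fin d) :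
    ContDiff ℝ M (fun s : ℝ => latticeFT f (Function.update k j s)) := by
  refine contDiff_iff_iteratedDeriv.2 ⟨fun m hm => ?_, fun m hm => ?_⟩
  · have hm' : m ≤ M := by exact_mod_cast hm
    rw [iteratedDeriv_latticeFT_update hM k j m hm']
    exact (continuous_latticeFTDn hM j hm').comp (continuous_const.update j continuous_id)
  · have hm' : m < M := by exact_mod_cast hm
    rw [iteratedDeriv_latticeFT_update hM k j m hm'.le]
    intro s
    have h0 : Summable fun x => |coordPow j m f x| := summable_abs_coordPow hM j hm'.le
    have h1 : Summable fun x => |coordMul j (coordPow j m f) x| := by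
      rw [← coordPow_succ]
      exact summable_abs_coordPow hM j hm'
    have h := ((hasDerivAt_latticeFT_update h0 j h1 (Function.update k j s) s).const_mul
      ((-Complex.I) ^ m)).differentiableAt
    simp only [Function.update_idem] at h
    simp only [latticeFTDn]
    exact h

/-- `C^M` at a point, the form consumed by the Leibniz rule `iteratedDeriv_mul`. [folklore] -/
theorem contDiffAt_latticeFT_update {f : Site d → ℝ} {M : ℕ}
    (hM : Summable fun x => (1 + euclidNorm x) ^ M * |f x|) (k : Fin d → ℝ) (j : Fin d) (s : ℝ) :
    ContDiffAt ℝ M (fun s : ℝ => latticeFT f (Function.update k j s)) s :=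
  (contDiff_latticeFT_update hM k j).contDiffAt

/-! ### The first derivative vanishes on `k_j = 0`: `|∂_j f̂(k)| ≤ K₂ |k_j|` for symmetric `f` -/

/-- `|k_j| ≤ |k|`. [folklore] -/
theorem abs_apply_le_knorm (k : Fin d → ℝ) (j : Fin d) : |k j| ≤ knorm k := by
  rw [knorm, ← Real.sqrt_sq_eq_abs]
  exact Real.sqrt_le_sqrt (Finset.single_le_sum (fun i _ => sq_nonneg (k i)) (Finset.mem_univ j))

/-- **`|∂_j f̂(k)| ≤ (Σ_x |x|²|f(x)|) |k_j|`** for a `ℤ^d`-symmetric `f` with finite second moment: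
the first coordinate derivative is odd in `k_j`, so it vanishes on the hyperplane `k_j = 0` at a
linear rate (the case `ℓ = 1` of Hara's (4.22); this is `norm_latticeFT_coordMul_le` through the
bridge `latticeFTDn_one`). [cite: Hara2008, proof of Lemma 4.1 ((4.22))] -/
theorem norm_latticeFTDn_one_le_abs {f : Site d → ℝ} (hfs : IsZdSymmetric f)
    (h0 : Summable fun x => |f x|) (h2 : Summable fun x => euclidNorm x ^ 2 * |f x|) (j : Fin d)
    (k : Fin d → ℝ) :
    ‖latticeFTDn f j 1 k‖ ≤ (∑' x, euclidNorm x ^ 2 * |f x|) * |k j| := by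
  rw [latticeFTDn_one, norm_mul, norm_neg, Complex.norm_I, one_mul]
  exact norm_latticeFT_coordMul_le hfs h0 h2 j k

/-- **`|∂_j f̂(k)| ≤ (Σ_x |x|²|f(x)|) |k|`**, the isotropic form consumed by Lemma 4.1
(`|k_j| ≤ |k|`). [cite: Hara2008, proof of Lemma 4.1 ((4.22))] -/
theorem norm_latticeFTDn_one_le {f : Site d → ℝ} (hfs : IsZdSymmetric f)
    (h0 : Summable fun x => |f x|) (h2 : Summable fun x => euclidNorm x ^ 2 * |f x|) (j : Fin d)
    (k : Fin d → ℝ) :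
    ‖latticeFTDn f j 1 k‖ ≤ (∑' x, euclidNorm x ^ 2 * |f x|) * knorm k :=
  (norm_latticeFTDn_one_le_abs hfs h0 h2 j k).trans
    (mul_le_mul_of_nonneg_left (abs_apply_le_knorm k j) (tsum_nonneg fun x => by positivity))

end Literature.Barriers.CriticalPhenomena
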